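import Summits.CriticalPhenomena.SAWScalingLimit.Theses.SAWLoopFugacityFlow
import Summits.CriticalPhenomena.SAWScalingLimit.Theorems.AvoidanceLimit.Negative.AvoidanceLimitExponentRigidity
import Summits.CriticalPhenomena.SAWScalingLimit.Theorems.SAWLoopFugacityFlowAvoidanceLimitAnchorDefs
import Summits.CriticalPhenomena.SAWScalingLimit.Theorems.SAWLoopFugacityFlowAvoidanceLimitSawEndpoint
import Literature.Probability.LatticeModels.DiluteLoopModelIsing
import Literature.Probability.LatticeModels.DiluteLoopModelAnalyticity
import Literature.Probability.RandomPlanarGeometry.HullSubdomainPullback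
import Literature.Probability.RandomPlanarGeometry.JordanDomainProofs
import Literature.Probability.RandomPlanarGeometry.RestrictionHullsProofs

/-!
# Strategist s2 sketch — the route's OWN `n = 1` mechanism TYPED as a line for `AvoidanceLimit`
# (stmt-CriticalPhenomena-10649): Ising anchor at `(n, w) = (1, ½)` → window → analyticity on `[0, 1]`

NOT registered (no `skeleton check`; the live skeleton is untouched). Purpose: (i) the census entry D6
"attempted with result"; (ii) Lean signatures the tenure planner can give to the route's INFORMAL items
`IsingWindow` (stmt-CriticalPhenomena-5080) and `FugacityAnalyticity` (stmt-CriticalPhenomena-5063) now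
that `Literature.Probability.LatticeModels.DiluteLoopModel` (+ `…Ising`, `…SAW`, `…SAWLaw`,
`…Analyticity`) has landed; (iii) a kernel-checked composition `AvoidanceLimit_of_ising` showing the five
statements conclude the crux BY NAME (sorries only in `stub_*`).

Family: the OSCULATING diagonal `L(s) = ⟨s, s/2, x_c(s, s/2)⟩` of the tree's dilute non-crossing loop
model on `Ω_δ ⊆ δℤ²` (collisions allowed, weight `w = s/2`), `s ∈ [0, 1]` — the route thesis' path; at
`s = 1` it is EXACTLY the free-b.c. Ising high-temperature expansion (`partitionFunction_one_half`,
`twoLeg_one_half_tanh_eq_isingTwoPoint`), at `s = 0` the SAW. All weights are NONNEGATIVE on the segment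
(`weight_nonneg`, `twoLeg_pos_of_path`): the ratio is a positive real number at every mesh, pole-free
near `[0, 1]` at FIXED mesh (`exists_isOpen_differentiableOn_diag_domainBoundaryRatio`) — the content of
the continuation stub is δ-UNIFORMITY only. Contrast: the live line's family `(s, t = s/2, w = 0)`,
`s ∈ [-2, 0]`, has SIGNED weights and a √-branch point of `bExp` at its anchor.
-/

noncomputable section

open scoped Topology
open Filter Set
open Literature.Probability.RandomPlanarGeometry Literature.Probability.LatticeModels
open Summit.CriticalPhenomena.SAWScalingLimit.Theses.SAWLoopFugacityFlow (AvoidanceLimit)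
open Summit.CriticalPhenomena.SAWScalingLimit.Theorems.AvoidanceLimit.Anchor
  (confinedGraph confinedGraph_le_zdGraph Rδ Rδ_ofReal bExp bExp_zero bExp_one Rδ_dimerFugacity_zero
    stub_sawEndpoint)

namespace Summit.CriticalPhenomena.SAWScalingLimit.Cruxes.AvoidanceLimit.IsingWindowContinuation

/-! ## 1. Objects -/

/-- **`R^osc_δ(n, w, x; Ω, S)`** — the route's doubly normalised two-leg boundary ratio for the
OSCULATING family: `DiluteLoopModel.boundaryRatio ⟨n, w, x⟩` with numerator on the confined graph
(edges of `Ω_δ` whose closed segment lies in `closure S`) and denominator on `Ω_δ`, common volume. -/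
def RO {K : Type*} [Field K] (n w x : K) (Ω S : Set ℂ) (δ : ℝ) (a b : Site 2) : K :=
  (⟨n, w, x⟩ : DiluteLoopModel K).boundaryRatio (confinedGraph Ω S δ) (meshDomainFinset Ω δ)
    (discreteDomainGraph Ω δ) (meshDomainFinset Ω δ) a b

/-- `R^osc` commutes with `ℝ → ℂ`. -/
theorem RO_ofReal (n w x : ℝ) (Ω S : Set ℂ) (δ : ℝ) (a b : Site 2) :
    RO (n : ℂ) (w : ℂ) (x : ℂ) Ω S δ a b = ((RO n w x Ω S δ a b : ℝ) : ℂ) := by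
  have h := DiluteLoopModel.map_boundaryRatio (L := (⟨n, w, x⟩ : DiluteLoopModel ℝ)) Complex.ofRealHom
    (confinedGraph Ω S δ) (meshDomainFinset Ω δ) (discreteDomainGraph Ω δ) (meshDomainFinset Ω δ) a b
  simpa [RO, DiluteLoopModel.map] using h.symm

/-- At `(n, w) = (0, 0)` the osculating ratio IS the live line's `Rδ 0 0 x` (dimers switched off). -/
theorem RO_zero_zero (x : ℝ) (Ω S : Set ℂ) (δ : ℝ) (a b : Site 2) :
    RO (0 : ℝ) 0 x Ω S δ a b = Rδ (0 : ℝ) 0 x Ω S δ a b := by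
  rw [RO, Rδ_dimerFugacity_zero]

/-- **The osculating critical curve** `x_c(s) := x_c(s, s/2)` (tree: `DiluteLoopModel.criticalFugacity`,
boundedness threshold of the half-plane two-leg susceptibility — the right convention for the
NONNEGATIVE weights of `s ≥ 0`), read in `ℝ` (junk `0` if `= ⊤`). -/
def xcOsc (s : ℝ) : ℝ := (DiluteLoopModel.criticalFugacity s (s / 2)).toReal

/-! ## 2. The statements of the line -/

/-- **I1 · SAWPointOsc** (known, M; Hammersley–Welsh as in the landed `Anchor.stub_sawCriticalPoint`, but for
the boundedness-threshold convention): `x_c(0, 0) = 1/μ(ℤ²)`. -/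
def SAWPointOsc : Prop := xcOsc 0 = SAW.criticalFugacity

/-- **I2 · IsingAnchorOsc** (the `n = 1` ANCHOR in confined-graph form; L–XL): along every hull datum the
ratio at `(1, ½, √2 − 1)` — by `twoLeg_one_half_tanh_eq_isingTwoPoint` + `tanh_criticalBetaTwo` a ratio
of FREE-b.c. critical Ising boundary two-point functions, numerator on the confined graph — tends to
`d^{1/2} = d^{bExp 1}` (boundary spin = weight-½ primary; s-holomorphic fermion on ℤ²: CHI15,
Hongler–Kytölä 13; rough domains / arbitrary endpoint approximations NOT in print: cf. item
IsingBoundaryRatio stmt-CriticalPhenomena-10650, which is the `discreteDomainGraph D'`-numerator twin). -/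
def IsingAnchorOsc : Prop :=
  ∀ (D D' : DobrushinDomain) (a b : ℝ → Site 2), SAW.IsEndpointApprox D a b →
    D'.carrier ⊆ D.carrier → D'.pt 0 = D.pt 0 → D'.pt 1 = D.pt 1 →
    (∃ ε : ℝ, 0 < ε ∧ D'.carrier ∩ Metric.ball (D.pt 0) ε = D.carrier ∩ Metric.ball (D.pt 0) ε ∧
      D'.carrier ∩ Metric.ball (D.pt 1) ε = D.carrier ∩ Metric.ball (D.pt 1) ε) →
    ∀ (φ : ConformalEquiv UpperHalfPlane.upperHalfPlaneSet D.carrier), D.IsChordalUniformizing φ →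
    ∀ (A : Set ℂ), A = closure (UpperHalfPlane.upperHalfPlaneSet \
      {z | z ∈ UpperHalfPlane.upperHalfPlaneSet ∧ φ z ∈ D'.carrier}) →
    ∀ (Φ : ConformalEquiv (UpperHalfPlane.upperHalfPlaneSet \ A) UpperHalfPlane.upperHalfPlaneSet)
      (d : ℝ), IsRestrictionMap A Φ → HasRestrictionDeriv A Φ d →
    Tendsto (fun δ => RO (1 : ℝ) 2⁻¹ (Real.sqrt 2 - 1) D.carrier D'.carrier δ (a δ) (b δ))
      (𝓝[>] 0) (𝓝 (d ^ ((1 : ℝ) / 2)))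

/-- **I3 · IsingWindowOsc** (conclusion; the stub is `IsingAnchorOsc → IsingWindowOsc`; XL, HARDEST, and —
honest — WITHOUT an identified small parameter: the deformation `s : 1 → 1 − ε` changes `c`, the
loop weight is non-local, and in the orientation-phase (Kac–Ward-twisted) Grassmann form the
crossing-removal quartic coupling is `O(1)`, cancelling only globally at `s = 1`): there is `ε₀ ∈ (0, 1]`
with `lim_δ R^osc_δ(s, s/2, x_c(s)) = d^{bExp s}` for every `s ∈ [1 − ε₀, 1]` and every hull datum. -/
def IsingWindowOsc : Prop :=
  ∃ ε₀ : ℝ, 0 < ε₀ ∧ ε₀ ≤ 1 ∧ ∀ s ∈ Set.Icc (1 - ε₀) (1 : ℝ),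
    ∀ (D D' : DobrushinDomain) (a b : ℝ → Site 2), SAW.IsEndpointApprox D a b →
    D'.carrier ⊆ D.carrier → D'.pt 0 = D.pt 0 → D'.pt 1 = D.pt 1 →
    (∃ ε : ℝ, 0 < ε ∧ D'.carrier ∩ Metric.ball (D.pt 0) ε = D.carrier ∩ Metric.ball (D.pt 0) ε ∧
      D'.carrier ∩ Metric.ball (D.pt 1) ε = D.carrier ∩ Metric.ball (D.pt 1) ε) →
    ∀ (φ : ConformalEquiv UpperHalfPlane.upperHalfPlaneSet D.carrier), D.IsChordalUniformizing φ →
    ∀ (A : Set ℂ), A = closure (UpperHalfPlane.upperHalfPlaneSet \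
      {z | z ∈ UpperHalfPlane.upperHalfPlaneSet ∧ φ z ∈ D'.carrier}) →
    ∀ (Φ : ConformalEquiv (UpperHalfPlane.upperHalfPlaneSet \ A) UpperHalfPlane.upperHalfPlaneSet)
      (d : ℝ), IsRestrictionMap A Φ → HasRestrictionDeriv A Φ d →
    Tendsto (fun δ => RO s (s / 2) (xcOsc s) D.carrier D'.carrier δ (a δ) (b δ))
      (𝓝[>] 0) (𝓝 (d ^ bExp s))

/-- **I4 · FugacityContinuation01** (= a typed form of the route's FugacityAnalyticity, L–XL): ONE connected
complex neighbourhood `U` of the WHOLE segment `[0, 1]` inside the strip `-2 < Re z < 2` (no branch point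
of `bExp` on `[0, 1]`), an analytic continuation `Xc` of the osculating critical curve off `[0, 1]`, and,
for every hull geometry, δ-UNIFORM analyticity and boundedness of `z ↦ R^osc_δ(z, z/2, Xc z)` on `U`
(pole-freeness at fixed mesh near `[0, 1]` is automatic for the nonnegative weights —
`DiluteLoopModel.exists_isOpen_differentiableOn_diag_domainBoundaryRatio`; the content is the uniformity:
a Lee–Yang-type zero-free region in the complex loop fugacity at the critical edge fugacity, uniform in
the volume). -/
def FugacityContinuation01 : Prop :=
  ∃ (U : Set ℂ) (Xc : ℂ → ℂ),
    IsOpen U ∧ IsPreconnected U ∧ U ⊆ {z : ℂ | -2 < z.re ∧ z.re < 2} ∧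
    (∀ s : ℝ, s ∈ Set.Icc (0 : ℝ) 1 → (s : ℂ) ∈ U) ∧ DifferentiableOn ℂ Xc U ∧
    (∀ s : ℝ, (s : ℂ) ∈ U → 0 ≤ s → Xc s = (xcOsc s : ℂ)) ∧
    ∀ (D D' : DobrushinDomain) (a b : ℝ → Site 2), SAW.IsEndpointApprox D a b →
      D'.carrier ⊆ D.carrier → D'.pt 0 = D.pt 0 → D'.pt 1 = D.pt 1 →
      (∃ ε : ℝ, 0 < ε ∧ D'.carrier ∩ Metric.ball (D.pt 0) ε = D.carrier ∩ Metric.ball (D.pt 0) ε ∧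
        D'.carrier ∩ Metric.ball (D.pt 1) ε = D.carrier ∩ Metric.ball (D.pt 1) ε) →
      ∃ δ₀ : ℝ, 0 < δ₀ ∧ ∃ M : ℝ, ∀ δ ∈ Set.Ioo (0 : ℝ) δ₀,
        DifferentiableOn ℂ (fun z : ℂ => RO z (z / 2) (Xc z) D.carrier D'.carrier δ (a δ) (b δ)) U ∧
        ∀ z ∈ U, ‖RO z (z / 2) (Xc z) D.carrier D'.carrier δ (a δ) (b δ)‖ ≤ M

/-- **I5 · Vitali01** (pure complex analysis, provable now, M — the `[0, 1]`-segment twin of the LANDED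
`Anchor.stub_vitaliTransport`, whose window interval is hard-wired inside `[-2+η, 0]`): a normal family on
`U ⊇ [0, 1]` converging on a real sub-interval `(s₁, s₂) ⊆ [0, 1]` to `d^{bExp s}` converges at `0` to
`d^{5/8}` (Vitali–Porter + identity theorem with the explicit strip continuation of `d^{bExp}`). -/
def Vitali01 : Prop :=
  ∀ (U : Set ℂ), IsOpen U → IsPreconnected U →
    U ⊆ {z : ℂ | -2 < z.re ∧ z.re < 2} → (∀ s : ℝ, s ∈ Set.Icc (0 : ℝ) 1 → (s : ℂ) ∈ U) →
    ∀ (f : ℝ → ℂ → ℂ) (M δ₀ : ℝ), 0 < δ₀ →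
    (∀ δ ∈ Set.Ioo (0 : ℝ) δ₀, DifferentiableOn ℂ (f δ) U ∧ ∀ z ∈ U, ‖f δ z‖ ≤ M) →
    ∀ d : ℝ, 0 < d → ∀ s₁ s₂ : ℝ, 0 ≤ s₁ → s₁ < s₂ → s₂ ≤ 1 →
    (∀ s ∈ Set.Ioo s₁ s₂, Tendsto (fun δ => f δ s) (𝓝[>] 0) (𝓝 ((d ^ bExp s : ℝ) : ℂ))) →
    Tendsto (fun δ => f δ 0) (𝓝[>] 0) (𝓝 ((d ^ ((5 : ℝ) / 8) : ℝ) : ℂ))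

/-! ## 3. Stubs (sorried; NOT registered) -/

theorem stub_sawPointOsc : SAWPointOsc := by sorry
theorem stub_isingWindowOsc : IsingAnchorOsc → IsingWindowOsc := by sorry
theorem stub_isingAnchorOsc : IsingAnchorOsc := by sorry
theorem stub_fugacityContinuation01 : FugacityContinuation01 := by sorry
theorem stub_vitali01 : Vitali01 := by sorry

/-! ## 4. Glue (no sorry) -/

theorem eventually_good {D : DobrushinDomain} {a b : ℝ → Site 2} (hab : SAW.IsEndpointApprox D a b) :
    ∀ᶠ δ in 𝓝[>] (0 : ℝ), 0 < δ ∧ a δ ≠ b δ := by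
  have h0 : ∀ᶠ δ in 𝓝[>] (0 : ℝ), 0 < δ := eventually_mem_nhdsWithin
  have hpq : D.pt 0 ≠ D.pt 1 := fun h => absurd (D.pt_injective h) (by decide)
  have hr : 0 < dist (D.pt 0) (D.pt 1) / 2 := by
    have := dist_pos.2 hpq
    positivity
  have ha := (Metric.tendsto_nhds.1 hab.tendsto_fst) _ hr
  have hb := (Metric.tendsto_nhds.1 hab.tendsto_snd) _ hr
  have hne : ∀ᶠ δ in 𝓝[>] (0 : ℝ), a δ ≠ b δ := by
    filter_upwards [ha, hb] with δ hδa hδb heq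
    rw [heq] at hδa
    have h3 := dist_triangle (D.pt 0) (meshPoint δ (b δ)) (D.pt 1)
    rw [dist_comm] at hδa
    linarith
  filter_upwards [h0, hne] with δ hδ hne using ⟨hδ, hne⟩

theorem isHullSubdomain_of_ball {D D' : DobrushinDomain} (hsub : D'.carrier ⊆ D.carrier)
    (h0 : D'.pt 0 = D.pt 0) (h1 : D'.pt 1 = D.pt 1)
    (hball : ∃ ε : ℝ, 0 < ε ∧ D'.carrier ∩ Metric.ball (D.pt 0) ε = D.carrier ∩ Metric.ball (D.pt 0) ε ∧
      D'.carrier ∩ Metric.ball (D.pt 1) ε = D.carrier ∩ Metric.ball (D.pt 1) ε) :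
    D.IsHullSubdomain D' := by
  obtain ⟨ε, hε, hb0, hb1⟩ := hball
  have key : ∀ p : ℂ, D'.carrier ∩ Metric.ball p ε = D.carrier ∩ Metric.ball p ε →
      p ∉ closure (D.carrier \ D'.carrier) := by
    intro p hp hmem
    rw [mem_closure_iff_nhds] at hmem
    obtain ⟨z, hzb, hzD, hzD'⟩ := hmem (Metric.ball p ε) (Metric.ball_mem_nhds p hε)
    have hz : z ∈ D'.carrier ∩ Metric.ball p ε := by rw [hp]; exact ⟨hzD, hzb⟩
    exact hzD' hz.1
  exact ⟨hsub, h0, h1, key _ hb0, key _ hb1⟩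

/-- **Composition (kernel-checked, no `sorry` here): the five statements imply `AvoidanceLimit` BY NAME.**
Anchor ⇒ window on `[1 − ε₀, 1]` along `xcOsc`; continuation on `U ⊇ [0, 1]`; Vitali transport of
`d^{bExp}` from `(1 − ε₀, 1)` to `0` (`0 < d`: the chordal pull-back is a `*`-hull); at `0` the curve is
the SAW point; at `(0, 0, x_c)` the osculating ratio is `Rδ 0 0 x_c`, i.e. the avoidance probability
(landed `Anchor.stub_sawEndpoint`). -/
theorem AvoidanceLimit_of_ising :
    SAWPointOsc → IsingAnchorOsc → (IsingAnchorOsc → IsingWindowOsc) → FugacityContinuation01 →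
      Vitali01 → AvoidanceLimit := by
  intro h7 hAnch h4 h5 h6 D D' a b hab hsub hp0 hp1 hball φ hφ A hA Φ d hΦ hd
  -- (0) `0 < d`
  have hHull : D.IsHullSubdomain D' := isHullSubdomain_of_ball hsub hp0 hp1 hball
  have hstar : IsStarHull A := by
    rw [hA]
    exact IsStarHull.pullbackHull JordanDomain.isSimplyConnected_holds hφ hHull
  obtain ⟨d', hd'0, -, hd'⟩ := IsStarHull.exists_hasRestrictionDeriv_holds hstar hΦ
  have hdpos : 0 < d := by rwa [hd.unique hstar hd']
  -- (1) window
  obtain ⟨ε₀, hε₀, hε₁, hW⟩ := h4 hAnch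
  -- (2) continuation
  obtain ⟨U, Xc, hUo, hUc, hUstrip, hUseg, -, hXreal, hB⟩ := h5
  obtain ⟨δ₀, hδ₀, M, hFM⟩ := hB D D' a b hab hsub hp0 hp1 hball
  set f : ℝ → ℂ → ℂ := fun δ z => RO z (z / 2) (Xc z) D.carrier D'.carrier δ (a δ) (b δ) with hf
  have hreal : ∀ s : ℝ, (s : ℂ) ∈ U → 0 ≤ s → ∀ δ,
      f δ s = ((RO s (s / 2) (xcOsc s) D.carrier D'.carrier δ (a δ) (b δ) : ℝ) : ℂ) := by
    intro s hsU hs0 δ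
    simp only [hf]
    rw [hXreal s hsU hs0, show (s : ℂ) / 2 = ((s / 2 : ℝ) : ℂ) by push_cast; ring, RO_ofReal]
  -- (3) pointwise limits on `(1 - ε₀, 1)` from the window
  have hlim : ∀ s ∈ Set.Ioo (1 - ε₀) 1,
      Tendsto (fun δ => f δ s) (𝓝[>] 0) (𝓝 ((d ^ bExp s : ℝ) : ℂ)) := by
    intro s hs
    have hs0 : 0 ≤ s := by linarith [hs.1]
    have hsU : (s : ℂ) ∈ U := hUseg s ⟨hs0, hs.2.le⟩
    have hw := hW s ⟨hs.1.le, hs.2.le⟩ D D' a b hab hsub hp0 hp1 hball φ hφ A hA Φ d hΦ hd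
    have hfun : (fun δ => f δ s) =
        fun δ => ((RO s (s / 2) (xcOsc s) D.carrier D'.carrier δ (a δ) (b δ) : ℝ) : ℂ) :=
      funext (hreal s hsU hs0)
    rw [hfun]
    exact (Complex.continuous_ofReal.tendsto _).comp hw
  -- (4) Vitali transport to `0`
  have key := h6 U hUo hUc hUstrip hUseg f M δ₀ hδ₀ hFM d hdpos (1 - ε₀) 1 (by linarith) (by linarith)
    le_rfl hlim
  -- (5) at `0`: the SAW point and the avoidance probability
  have h0U : ((0 : ℝ) : ℂ) ∈ U := hUseg 0 ⟨le_rfl, by norm_num⟩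
  have hf0 : ∀ δ, f δ 0 =
      ((Rδ (0 : ℝ) 0 SAW.criticalFugacity D.carrier D'.carrier δ (a δ) (b δ) : ℝ) : ℂ) := by
    intro δ
    have h := hreal 0 h0U le_rfl δ
    have h7' : xcOsc 0 = SAW.criticalFugacity := h7
    rw [zero_div, h7', RO_zero_zero] at h
    simpa using h
  have hC : Tendsto (fun δ => ((Rδ (0 : ℝ) 0 SAW.criticalFugacity D.carrier D'.carrier δ (a δ) (b δ) : ℝ) : ℂ))
      (𝓝[>] 0) (𝓝 ((d ^ ((5 : ℝ) / 8) : ℝ) : ℂ)) := by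
    have hfun : (fun δ => f δ 0) =
        fun δ => ((Rδ (0 : ℝ) 0 SAW.criticalFugacity D.carrier D'.carrier δ (a δ) (b δ) : ℝ) : ℂ) :=
      funext hf0
    rw [← hfun]
    exact key
  have hR : Tendsto (fun δ => Rδ (0 : ℝ) 0 SAW.criticalFugacity D.carrier D'.carrier δ (a δ) (b δ))
      (𝓝[>] 0) (𝓝 (d ^ ((5 : ℝ) / 8))) := by
    have h := (Complex.continuous_re.tendsto _).comp hC
    rw [Complex.ofReal_re] at h
    exact h.congr' (Eventually.of_forall fun δ => Complex.ofReal_re _)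
  refine (ENNReal.tendsto_ofReal hR).congr' ?_
  filter_upwards [eventually_good hab] with δ hδ
  exact (stub_sawEndpoint D.carrier D'.carrier δ (a δ) (b δ) D.isBounded hδ.1 hδ.2).symm

/-- The crux modulo the five sorried statements. -/
example : AvoidanceLimit :=
  AvoidanceLimit_of_ising stub_sawPointOsc stub_isingAnchorOsc stub_isingWindowOsc
    stub_fugacityContinuation01 stub_vitali01

/-! ## 5. Sanity: the anchor's ratio IS a ratio of free Ising two-point functions (tree identity) -/

/-- At `(1, ½, tanh β)` the osculating two-leg function on any finite piece is the free Ising two-point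
function (`twoLeg_one_half_tanh_eq_isingTwoPoint`); hence `RO 1 ½ (√2 − 1)` is the ratio of free CRITICAL
Ising boundary two-point functions, numerator with couplings on the confined graph. -/
example (β : ℝ) {Λ : Finset (Site 2)} {a b : Site 2} (ha : a ∈ Λ) (hb : b ∈ Λ) (Ω S : Set ℂ) (δ : ℝ) :
    (⟨1, 2⁻¹, Real.tanh β⟩ : DiluteLoopModel ℝ).twoLeg (confinedGraph Ω S δ) Λ a b =
      isingTwoPoint (confinedGraph Ω S δ) Λ β 0 .free a b :=
  DiluteLoopModel.twoLeg_one_half_tanh_eq_isingTwoPoint β ha hb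

example : bExp 1 = 1 / 2 ∧ bExp 0 = 5 / 8 := ⟨bExp_one, bExp_zero⟩

end Summit.CriticalPhenomena.SAWScalingLimit.Cruxes.AvoidanceLimit.IsingWindowContinuation

end
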